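import Summits.Parity.GeneralizedHardyLittlewood.Theorems.ModelHyperbolicity.Negative.ModelHyperbolicityUniformFalse
import Summits.Parity.GeneralizedHardyLittlewood.Theorems.ModelHyperbolicity.Negative.ModelHyperbolicityNotMonotone

/-!
# `ModelHyperbolicity` (stmt-Parity-14110): the TOP-THREE-CELL obstruction (first Newton inequality)

Part 4 of the cdisprove seat's lemmas. If `A_D > 0` is the top non-vanishing cell (`D ≥ 3`), the
reduced polynomial `Q_{u,x}` has degree `D − 1`; were all its zeros real, `e₁ = −A_{D−1}/A_D`,
`e₂ = A_{D−2}/A_D` and Cauchy–Schwarz `(Σ rᵢ)² ≤ (D−1)·Σ rᵢ²` (`sq_sum_le_card_mul_sum_sq`) with Newton's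
identity `Σ rᵢ² = e₁² − 2e₂` (`sum_map_sq_eq`, part 2) give `(D−2)·A_{D−1}² ≥ 2(D−1)·A_D·A_{D−2}`
(`D = 3`: the discriminant). Hence
`not_realRootedAt_of_top_cells : (D−2)·A_{D−1}² < 2(D−1)·A_D·A_{D−2} ⇒ ¬ RealRootedAt u x` —
the common mechanism of A1 (`x = 8`: `4,2,1`, an `example`), E1 (`1,2,7`,
`not_realRootedAt_of_cells_721`), `x₀(4) ≥ 481` (part 5) and of the numerically observed failures at
`x = B^u − 1` for every prime `B ≤ 13` (stabilised top cells `(2,7,15)`, `(4,17,78)`, `(15,182,1763)`,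
`(32,722,12329)`, `(402,29202,1247122)`, `(461,47696,2820952)`). Any future exact computation of three top
cells plugs into this lemma. [folklore]
-/

namespace Summit.Parity.GeneralizedHardyLittlewood.Theorems.ModelHyperbolicity.Negative

open Summit.Parity.GeneralizedHardyLittlewood.Theses.LeeYangFibres
open Finset Polynomial
open scoped Classical

/-! ## §G A reusable NEGATIVE criterion: the top-three-cell obstruction (first Newton inequality)

If `A_D > 0` is the top non-vanishing cell (`D ≥ 3`), the reduced polynomial `Q_{u,x}` has degree `D−1`
and, were all its zeros real, `e₁ = −A_{D−1}/A_D`, `e₂ = A_{D−2}/A_D` would satisfy Cauchy–Schwarz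
`(Σ rᵢ)² ≤ (D−1) Σ rᵢ²`, i.e. `(D−2)·A_{D−1}² ≥ 2(D−1)·A_D·A_{D−2}` (for `D = 3`: the discriminant
`A₂² ≥ 4A₁A₃`). So `(D−2)A_{D−1}² < 2(D−1)A_D A_{D−2}` ⇒ `¬ RealRootedAt u x`. This is the mechanism
behind A1 (`x = 8`: `4,2,1`), B2 (`x = 480`: `90,59,10`), E1 (`1,2,7`) and the numerically observed
failures at `x = B^u − 1` (stabilised cells in the docblock: there even `A_{D−1}² < 2A_D A_{D−2}`);
any future exact computation of three top cells plugs in here. -/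
/-- `im` of a multiset sum. -/

theorem im_multiset_sum (s : Multiset ℂ) : s.sum.im = (s.map Complex.im).sum := by
  induction s using Multiset.induction_on with
  | empty => simp
  | cons a s ih => simp [ih]

/-- Cauchy–Schwarz with ones: `(Σ r)² ≤ #s · Σ r²` for a multiset of reals. -/
theorem sq_sum_le_card_mul_sum_sq (s : Multiset ℝ) :
    s.sum ^ 2 ≤ (s.card : ℝ) * (s.map (fun r => r ^ 2)).sum := by
  induction s using Multiset.induction_on with
  | empty => simp
  | cons a s ih =>
    simp only [Multiset.sum_cons, Multiset.card_cons, Multiset.map_cons, Nat.cast_add, Nat.cast_one]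
    rcases Nat.eq_zero_or_pos s.card with h0 | hpos
    · have hs : s = 0 := Multiset.card_eq_zero.mp h0
      subst hs
      simp
    · have hn : (0 : ℝ) < (s.card : ℝ) := by exact_mod_cast hpos
      have key : (s.card : ℝ) * (((s.card : ℝ) + 1) * (a ^ 2 + (s.map (fun r => r ^ 2)).sum) - (a + s.sum) ^ 2)
          = ((s.card : ℝ) * a - s.sum) ^ 2
            + ((s.card : ℝ) + 1) * ((s.card : ℝ) * (s.map (fun r => r ^ 2)).sum - s.sum ^ 2) := by
        ring
      have hrhs : 0 ≤ ((s.card : ℝ) * a - s.sum) ^ 2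
            + ((s.card : ℝ) + 1) * ((s.card : ℝ) * (s.map (fun r => r ^ 2)).sum - s.sum ^ 2) := by
        nlinarith
      have hslack : 0 ≤ ((s.card : ℝ) + 1) * (a ^ 2 + (s.map (fun r => r ^ 2)).sum) - (a + s.sum) ^ 2 := by
        by_contra hneg
        have hneg' : ((s.card : ℝ) + 1) * (a ^ 2 + (s.map (fun r => r ^ 2)).sum) - (a + s.sum) ^ 2 < 0 :=
          lt_of_not_ge hneg
        have := mul_neg_of_pos_of_neg hn hneg'
        linarith
      linarith

/-- `Q_{u,x}` pushed to `ℂ[X]`. -/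
theorem cellPolyQ_map_coeff (u x i : ℕ) :
    ((cellPolyQ u x).map (algebraMap ℝ ℂ)).coeff i = if i < u then ((cell u x (i + 1) : ℕ) : ℂ) else 0 := by
  rw [coeff_map, cellPolyQ_coeff]
  split_ifs <;> simp

/-- TOP-THREE-CELL OBSTRUCTION (sharp first Newton inequality for the reduced polynomial):
`A_j = 0 (j > D)`, `A_D > 0`, `D ≥ 3`, `(D−2)·A_{D−1}² < 2(D−1)·A_D·A_{D−2}` ⇒ not real-rooted. -/
theorem not_realRootedAt_of_top_cells {u x D : ℕ} (hD : 3 ≤ D) (htop : ∀ j, D < j → cell u x j = 0)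
    (hpos : 0 < cell u x D)
    (hnewton : (D - 2) * cell u x (D - 1) ^ 2 < 2 * (D - 1) * cell u x D * cell u x (D - 2)) :
    ¬ RealRootedAt u x := by
  intro hreal
  have hu : 1 ≤ u := by
    rcases Nat.eq_zero_or_pos u with rfl | h
    · exact absurd hreal (not_realRootedAt_zero x)
    · exact h
  have hDu : D < u := by
    by_contra h
    have := cell_eq_zero_of_le (x := x) (j := D) hu (by omega)
    omega
  set P := (cellPolyQ u x).map (algebraMap ℝ ℂ) with hP
  have hcoeff : ∀ i, P.coeff i = if i < u then ((cell u x (i + 1) : ℕ) : ℂ) else 0 :=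
    cellPolyQ_map_coeff u x
  have hdeg : P.natDegree = D - 1 := by
    apply natDegree_eq_of_le_of_coeff_ne_zero
    · rw [natDegree_le_iff_coeff_eq_zero]
      intro N hN
      rw [hcoeff]
      split_ifs
      · rw [htop (N + 1) (by omega)]; simp
      · rfl
    · rw [hcoeff, if_pos (by omega), show D - 1 + 1 = D by omega]
      exact_mod_cast hpos.ne'
  have hlead : P.leadingCoeff = (cell u x D : ℂ) := by
    rw [leadingCoeff, hdeg, hcoeff, if_pos (by omega), show D - 1 + 1 = D by omega]
  have hlead0 : P.leadingCoeff ≠ 0 := by rw [hlead]; exact_mod_cast hpos.ne'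
  have hP0 : P ≠ 0 := leadingCoeff_ne_zero.mp hlead0
  have hroots : P.roots.card = P.natDegree := IsAlgClosed.card_roots_eq_natDegree
  have hv1 := coeff_eq_esymm_roots_of_card hroots (show D - 2 ≤ P.natDegree by omega)
  have hv2 := coeff_eq_esymm_roots_of_card hroots (show D - 3 ≤ P.natDegree by omega)
  rw [hdeg, hlead, hcoeff, if_pos (by omega), show D - 1 - (D - 2) = 1 by omega,
    show D - 2 + 1 = D - 1 by omega, esymm_one_eq_sum] at hv1
  rw [hdeg, hlead, hcoeff, if_pos (by omega), show D - 1 - (D - 3) = 2 by omega,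
    show D - 3 + 1 = D - 2 by omega] at hv2
  -- all roots of P are real: a root z of Q gives the root z of P_{u,x} = z·Q(z)
  have him : ∀ r ∈ P.roots, r.im = 0 := fun r hr =>
    hreal r (by rw [cellPoly_eq_mul_Q, (mem_roots hP0).mp hr, mul_zero])
  have hN := sum_map_sq_eq P.roots
  -- the roots are the real numbers R := roots.map re
  set R : Multiset ℝ := P.roots.map Complex.re with hR
  have hsumR : P.roots.sum = ((R.sum : ℝ) : ℂ) := by
    apply Complex.ext
    · rw [re_multiset_sum, Complex.ofReal_re]
    · rw [im_multiset_sum, Complex.ofReal_im, Multiset.sum_eq_zero]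
      intro y hy
      obtain ⟨r, hr, rfl⟩ := Multiset.mem_map.mp hy
      exact him r hr
  have hS : (P.roots.map (fun r => r ^ 2)).sum = (((R.map (fun r => r ^ 2)).sum : ℝ) : ℂ) := by
    apply Complex.ext
    · rw [re_multiset_sum, Multiset.map_map, Complex.ofReal_re, hR, Multiset.map_map]
      congr 1
      refine Multiset.map_congr rfl fun r hr => ?_
      simp only [Function.comp_apply, sq, Complex.mul_re, him r hr]
      ring
    · rw [im_multiset_sum, Multiset.map_map, Complex.ofReal_im, Multiset.sum_eq_zero]
      intro y hy
      obtain ⟨r, hr, rfl⟩ := Multiset.mem_map.mp hy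
      simp [sq, Complex.mul_im, him r hr]
  have hcardR : (R.card : ℝ) = (D - 1 : ℕ) := by
    rw [hR, Multiset.card_map, hroots, hdeg]
  have hCS := sq_sum_le_card_mul_sum_sq R
  rw [hcardR] at hCS
  -- Vieta in terms of real quantities
  have hs : (cell u x D : ℂ) * P.roots.sum = -(cell u x (D - 1) : ℂ) := by
    simp only [pow_one] at hv1
    linear_combination hv1
  have he2 : (cell u x D : ℂ) * P.roots.esymm 2 = (cell u x (D - 2) : ℂ) := by
    norm_num at hv2
    linear_combination -hv2
  -- A_D² Σr² = A_{D-1}² − 2 A_D A_{D−2}  and  A_D Σ r = −A_{D−1}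
  have key : ((cell u x D : ℕ) : ℂ) ^ 2 * (P.roots.map (fun r => r ^ 2)).sum =
      ((cell u x (D - 1) : ℕ) : ℂ) ^ 2 - 2 * ((cell u x D : ℕ) : ℂ) * ((cell u x (D - 2) : ℕ) : ℂ) := by
    rw [hN]
    linear_combination ((cell u x D : ℂ) * P.roots.sum - (cell u x (D - 1) : ℂ)) * hs
      - 2 * (cell u x D : ℂ) * he2
  rw [hS] at key
  rw [hsumR] at hs
  -- move the two identities to ℝ
  have hsR : (cell u x D : ℝ) * R.sum = -(cell u x (D - 1) : ℝ) := by
    apply Complex.ofReal_injective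
    push_cast
    exact hs
  have keyR : (cell u x D : ℝ) ^ 2 * (R.map (fun r => r ^ 2)).sum =
      (cell u x (D - 1) : ℝ) ^ 2 - 2 * (cell u x D : ℝ) * (cell u x (D - 2) : ℝ) := by
    apply Complex.ofReal_injective
    push_cast
    exact key
  have ha : (0 : ℝ) < (cell u x D : ℝ) := by exact_mod_cast hpos
  have hlt : ((D - 2 : ℕ) : ℝ) * (cell u x (D - 1) : ℝ) ^ 2 <
      2 * ((D - 1 : ℕ) : ℝ) * (cell u x D : ℝ) * (cell u x (D - 2) : ℝ) := by
    exact_mod_cast hnewton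
  have hD1 : ((D - 1 : ℕ) : ℝ) = ((D - 2 : ℕ) : ℝ) + 1 := by
    rw [show D - 1 = (D - 2) + 1 by omega]; push_cast; ring
  have hd0 : (0 : ℝ) ≤ ((D - 2 : ℕ) : ℝ) := by positivity
  -- (Σ r)² ≤ (D-1) Σ r², times A_D²:  A_{D-1}² ≤ (D-1)(A_{D-1}² - 2 A_D A_{D-2})
  have h1 : (cell u x D : ℝ) ^ 2 * R.sum ^ 2 ≤
      (cell u x D : ℝ) ^ 2 * (((D - 1 : ℕ) : ℝ) * (R.map (fun r => r ^ 2)).sum) :=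
    mul_le_mul_of_nonneg_left hCS (by positivity)
  have h2 : (cell u x D : ℝ) ^ 2 * R.sum ^ 2 = (cell u x (D - 1) : ℝ) ^ 2 := by
    have : ((cell u x D : ℝ) * R.sum) ^ 2 = (-(cell u x (D - 1) : ℝ)) ^ 2 := by rw [hsR]
    nlinarith
  rw [hD1] at hlt h1
  nlinarith

/-- A1 again (`not_realRootedAt_eight`, part 1), now as an INSTANCE of the criterion:
`(A₁,A₂,A₃)(8) = (4,2,1)`, `1·2² < 4·1·4`. -/
example (u : ℕ) (hu : 4 ≤ u) : ¬ RealRootedAt u 8 := by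
  have hx : (8 : ℕ) < 2 ^ u := lt_of_lt_of_le (by norm_num) (Nat.pow_le_pow_right (by norm_num) hu)
  have hcell : ∀ j, cell u 8 j = (lset 8 j).card := cell_eq_card_lset (by norm_num) hx (by omega)
  obtain ⟨h1, h2, h3⟩ := card_lset_eight
  refine not_realRootedAt_of_top_cells (D := 3) le_rfl ?_ ?_ ?_
  · intro j hj
    have : (8 : ℕ) < 2 ^ j := lt_of_lt_of_le (by norm_num) (Nat.pow_le_pow_right (by norm_num) hj)
    exact cell_eq_zero_of_lt this
  · rw [hcell, h3]; norm_num
  · rw [hcell, hcell, hcell]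
    simp only [show 3 - 1 = 2 from rfl, show 3 - 2 = 1 from rfl, h1, h2, h3]
    norm_num

/-- E1's endgame via the criterion: top cells `7, 2, 1` at indices `D−2, D−1, D` (`D ≥ 5`). -/
theorem not_realRootedAt_of_cells_721 {u x D : ℕ} (hD : 5 ≤ D) (htop : ∀ j, D < j → cell u x j = 0)
    (h0 : cell u x D = 1) (h1 : cell u x (D - 1) = 2) (h2 : cell u x (D - 2) = 7) : ¬ RealRootedAt u x :=
  not_realRootedAt_of_top_cells (by omega) htop (by omega) (by
    rw [h0, h1, h2]
    have : (D - 2) * 2 ^ 2 < 2 * (D - 1) * 1 * 7 := by omega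
    exact this)

end Summit.Parity.GeneralizedHardyLittlewood.Theorems.ModelHyperbolicity.Negative
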